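import Summits.QuantumFields.YangMills.Theorems.BalabanUVNodesN09ChartReadAveragingSharp
import Literature.MeasureTheory.Integral.AnalyticSubmersionSharpDensityFibreFlat
import Literature.MathematicalPhysics.QuantumFieldTheory.Balaban1983to89.Node00.RegSetOfLocalFaces
import Literature.MathematicalPhysics.QuantumFieldTheory.Balaban1983to89.B12ContinuousTransportInvarianceOn
import HarnessLib

/-!
# BalabanUVNodes ∕ N09 — THE LOCAL ROUTE (ROAD B) CLOSED BY NAME FOR THRESHOLD-CUT (SHARP) DENSITIES ON THE α-GUARD, modulo a displayed analytic threshold family: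
# every open set of coarse fields lies in the maximal regular set of the kernel transform of `ρ`, `HasContTransportOn` holds there and `TcanOfRecord ρ` is continuous —
# for every bounded density `ρ` on a closed subset of the loop α-guard that is continuous OFF the zero sets of fibrewise-analytic, nowhere-fibre-flat thresholds

Cell `pub-ymgap`, width seat `pub-ymgap-dag-n09-w2` generation 4 (HUMAN RULING D-0149; DAG node N09 = [Balaban1987RG1] §§2–5; INBOX CLAIM-7∕INTENT-13 l.36737).
`--kind proof --supports stmt-QuantumFields-27364 --as helper` (K1⁹ `StabilityBRunRowsAtRecordR13SepCoPHV`; count-neutral; theorems only, 0 def ∕ 0 instance ∕ 0 notation ∕ 0 sorry).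

THE THREE-SEAT JUNCTION.  Road B to N09's analytic inclusion `hreg` (K0e (F1) «Jacobian face of [I] (0.4)») needs, per fine configuration `U₀` of the support, a LOCAL
push-forward-density statement for the chart-read averaging `ψ_{U₀} : A ↦ (c ↦ Λ(Ū(Θ^B(A)·U₀)(c)·Ū(U₀)(c)⁻¹))` at `0`.  Three lanes supply the parts:
* dag-n09-w4 g5 (`…N09ChartReadAveragingSmooth∕Submersion∕Sharp`): `ψ_{U₀}` is measurable, real-ANALYTIC at `0` and `Dψ_{U₀}(0)` is ONTO, under the loop α-guard;
* dag-n09-w3 g5 (`Literature.MeasureTheory.Integral.AnalyticSubmersionSharpDensityFibreFlat`): the SHARP engine WITHOUT transversality — for an analytic submersion `M` at `a`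
  and a countable family of thresholds `Γ i : Y → E → ℝ`, analytic in the fine variable on a window `O₀ ∋ a`, every bounded measurable `r ≥ 0` on a smaller window `O`,
  continuous at the points where every `Γ i (M x) ·` is non-zero (or fibre-flat), has under `M` a push-forward density CONTINUOUS near `M a`;
* this seat (`Node00.RegSetOfLocalFaces`, v1.1 p626720): `regular_of_sharpEngineFaces` — sharp engine faces with a flat exemption family `Qflat U₀`, implying the
  configuration-space exemption `Q` through `Θ^B(·)·U₀`, glue (partition of unity on the compact fine-field space, chart transport in p28's exponential chart,
  (0.13) test identity) to: every open `U ⊆ regSetOfRecord`, `HasContTransportOn` on `U`, `TcanOfRecord ρ` continuous.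
This file composes them.  For CONTINUOUS densities (no threshold) the junction is dag-n09-w4 g5's `…N09ContTransportOfLoopSmall` (`regular_of_loopSmall`); here the density may
JUMP across the zero sets `{A | Γ U₀ i (ψ_{U₀} A) A = 0}` — the shape of the record's `χ^{(2.9)}` cut-off (`Node00.SmallFieldChi29OfRecord.chiFix29OfRecord` is `0∕1`-valued,
one threshold `fluctDevOfRecord … V b < ε₁` per non-`b₀` bond, each depending on `V` through the coarse value `V̄` and ONE bond variable `V b`).

CONTENTS (consumed BY NAME, nothing modified or restated).
§1 (run level `P : Params`) ★★ `sharpEngineFace_chartRead_avgFun_fibreFlat` — w3 g5's `exists_continuousOn_density_map_of_analytic_submersion_sharp_fibreFlat` APPLIED to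
   w4 g5's `measurable_chartRead_avgFun` ∕ `analyticAt_chartRead_avgFun` ∕ `fderiv_chartRead_avgFun_range_eq_top` (exemption «non-zero OR fibre-flat»);
   ★★ `sharpEngineFace_chartRead_avgFun_of_nowhereFibreFlat` — the same with the PLAIN exemption under the displayed nowhere-fibre-flat clause `hnf`
   (w3 g5's `…_of_nowhereFibreFlat`).
§2 (record level) ★★ `sharpEngineFaces_avOfRecord_of_loopSmall` — at every `U₀` of a set `K₀` inside the loop α-guard: continuity of `(avOfRecord F N K k).avg` at `U₀` AND the
   sharp engine face of its chart reading with the flat exemption `A ∈ O₀ U₀ ∧ ∀ i, Γ U₀ i (ψ_{U₀} A) A ≠ 0` — the hypothesis `hengine` of `regular_of_sharpEngineFaces` VERBATIM.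
§3 ★★★ `regular_of_loopSmall_sharp` (every open `U ⊆ regSetOfRecord` with `HasContTransportOn`, and `TcanOfRecord ρ` continuous — project with `.1 U hU` ∕ `.2`) and
   ★ `domAlt_subset_regSetOfRecord_of_loopSmall_sharp` (the `hreg` SHAPE `domAltOfRecord F N ν K (k+1) ⊆ regSetOfRecord F N K k ρ`).

DISPLAYED HYPOTHESES (never asserted).  The loop α-guard on `K₀` with the standing range (`α ≤ 1∕24`, `α < δ_N`, `157·α < L^{1−d}`); `ρ` measurable, `0 ≤ ρ ≤ C₀`, zero off the
closed `K₀`, continuous at each `U ∈ K₀` with `Q U`; per `U₀ ∈ K₀` a countable threshold family `Γ U₀ i : (coarse chart) → (fine chart) → ℝ`, real-analytic in the fine chart variable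
on an open window `O₀ U₀ ∋ 0`, NOWHERE FIBRE-FLAT there (`hnf`: a threshold vanishing at `A` does not vanish identically near `A` along the fibre `ψ_{U₀}⁻¹(ψ_{U₀} A)` — at the record:
the open projection of the averaging fibre onto the non-central bond variables, dag-n09-w3 g5's announced `nowhereFibreFlat_of_submersiveCoordinates`), and the link
`hQ : A ∈ O₀ U₀ → (∀ i, Γ U₀ i (ψ_{U₀} A) A ≠ 0) → Q(Θ^B(A)·U₀)` («off the thresholds the density is continuous»).  For the record's `χ^{(2.9)}` the family is the
finite set of analytic determinant charts `A ↦ det(V^{(k)}(W)(b)⁻¹·Θ(A b)·U₀(b) − z)`, `|z| = 1`, `|z − 1| = ε₁` (dag-n09-w3's `…N09FibreThresholdNullOfAnalyticChart`) — NOT typed here.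

HONEST FRAMING.  LOCATED, count-neutral junction BY NAME (two `exact`s over the siblings' theorems and one over this seat's door); NO chart of Bałaban's constructed, NO estimate;
the (2.9) thresholds' analytic charts, `hnf` and the continuity of the record's β-input off the thresholds are NOT proved here; `hreg` at the record's sharp density NOT
discharged; N09 NOT discharged; conjunct 1 (Lemma 4) ∕ FLAG №7 untouched; K0⁷ ∕ K1⁹ ∕ K2⁹ ∕ K3⁸ NOT closed; counts unmoved (typed 28∕28 · discharged 5∕28); no summit statement is
proved here; R4 = the conditional finite-𝕋⁴ rung `BalabanLadder.UV` only — NOT continuum ∕ ℝ⁴ ∕ OS; the Yang–Mills mass gap (Clay) is NOT proved by any of this.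
-/

noncomputable section

open scoped Matrix.Norms.L2Operator Topology ENNReal
open Filter Set Function MeasureTheory

namespace Summit.QuantumFields.YangMills.BalabanUVNodes.N09ContTransportOfLoopSmallSharp

open Literature.MathematicalPhysics.QuantumFieldTheory.Balaban1983to89
open Literature.MathematicalPhysics.QuantumFieldTheory.Balaban1983to89.HaarExponentialChart
open Literature.MathematicalPhysics.QuantumFieldTheory.Balaban1983to89.BlockAveraging (Small Idx avgFun loopHol)
open Literature.MathematicalPhysics.QuantumFieldTheory.Balaban1983to89.ExpMeanLog (expMeanLogSU deltaSU)
open Literature.MathematicalPhysics.QuantumFieldTheory.Balaban1983to89.Node00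
open Literature.MeasureTheory.Integral.AnalyticSubmersion
  (exists_continuousOn_density_map_of_analytic_submersion_sharp_fibreFlat
    exists_continuousOn_density_map_of_analytic_submersion_sharp_of_nowhereFibreFlat)
open Summit.QuantumFields.YangMills.BalabanUVNodes.N09ChartReadAveragingSmooth
open Summit.QuantumFields.YangMills.BalabanUVNodes.N09ChartReadAveragingSubmersion
open Summit.QuantumFields.YangMills.BalabanUVNodes.N09ChartReadAveragingSharp

/-! ## §1  Run level: the sharp engine WITHOUT transversality applied to the chart-read averaging -/

section Run

variable {P : Params} {j : ℕ} {N : ℕ} [NeZero N]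
variable (U₀ : GaugeField P j (SU N))
variable [MeasurableSpace (specialUnitaryLogChart (Fin N)).lie] [BorelSpace (specialUnitaryLogChart (Fin N)).lie]
  (η : Measure (specialUnitaryLogChart (Fin N)).lie) [η.IsAddHaarMeasure]

/-- ★★ **(M3r)-LOCAL, SHARP ENGINE FORM WITHOUT TRANSVERSALITY (fibre-flat exemption).**  Under the loop α-guard at `U₀` (standing range), for every countable family of
thresholds `Γ i : (coarse chart) → (fine chart) → ℝ` real-analytic in the fine variable on an open window `O₀ ∋ 0`: open windows `O ∋ 0` (`O ⊆ O₀`), `D ∋ ψ_{U₀}(0)` such that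
every measurable `r ≥ 0` bounded on `O`, zero off `O`, and continuous at each `A ∈ O` at which every `Γ i (ψ_{U₀} A) ·` is non-zero OR vanishes identically near `A` along the
fibre `ψ_{U₀}⁻¹(ψ_{U₀} A)`, has under `ψ_{U₀}` a push-forward density w.r.t. `⊗η` CONTINUOUS on `D` — dag-n09-w3's
`AnalyticSubmersion.exists_continuousOn_density_map_of_analytic_submersion_sharp_fibreFlat` over dag-n09-w4's `measurable_chartRead_avgFun`, `analyticAt_chartRead_avgFun`,
`fderiv_chartRead_avgFun_range_eq_top`. [cite: Balaban1987RG1, (0.4) p.253, (2.1)–(2.10) pp.265–267; EvansGariepy1992, §3.4.3 Thm 2; Mityagin2015, Prop. 1] -/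
theorem sharpEngineFace_chartRead_avgFun_fibreFlat (hj : j + 1 ≤ P.m + P.K) {α : ℝ} (hα : ∀ c i, dist1 (loopHol U₀ c i) ≤ α) (hα24 : α ≤ 1 / 24)
    (hαδ : α < deltaSU (Fin N)) (hαL : 157 * α < ((P.L : ℝ) ^ (P.d - 1))⁻¹)
    {ι : Type*} [Countable ι]
    {Γ : ι → (PBond P (j + 1) → (specialUnitaryLogChart (Fin N)).lie) → (PBond P j → (specialUnitaryLogChart (Fin N)).lie) → ℝ}
    {O₀ : Set (PBond P j → (specialUnitaryLogChart (Fin N)).lie)} (hO₀ : IsOpen O₀) (h0 : (0 : PBond P j → (specialUnitaryLogChart (Fin N)).lie) ∈ O₀)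
    (hΓan : ∀ i y, AnalyticOnNhd ℝ (Γ i y) O₀) :
    ∃ O : Set (PBond P j → (specialUnitaryLogChart (Fin N)).lie), IsOpen O ∧ (0 : PBond P j → (specialUnitaryLogChart (Fin N)).lie) ∈ O ∧ O ⊆ O₀ ∧
      ∃ D : Set (PBond P (j + 1) → (specialUnitaryLogChart (Fin N)).lie), IsOpen D ∧
      (fun (A : PBond P j → (specialUnitaryLogChart (Fin N)).lie) (c : PBond P (j + 1)) =>
        (isChartRep_specialUnitaryGroup (n := Fin N)).logChart
          (avgFun (expMeanLogSU (n := Fin N)) (fun b => (isChartRep_specialUnitaryGroup (n := Fin N)).expChart (A b) * U₀ b) c *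
            (avgFun (expMeanLogSU (n := Fin N)) U₀ c)⁻¹)) 0 ∈ D ∧
      ∀ r : (PBond P j → (specialUnitaryLogChart (Fin N)).lie) → ℝ, Measurable r → (∀ A, 0 ≤ r A) →
        (∀ A ∈ O, (∀ i, Γ i ((fun (A : PBond P j → (specialUnitaryLogChart (Fin N)).lie) (c : PBond P (j + 1)) =>
            (isChartRep_specialUnitaryGroup (n := Fin N)).logChart
              (avgFun (expMeanLogSU (n := Fin N)) (fun b => (isChartRep_specialUnitaryGroup (n := Fin N)).expChart (A b) * U₀ b) c *
                (avgFun (expMeanLogSU (n := Fin N)) U₀ c)⁻¹)) A) A ≠ 0 ∨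
          ∀ᶠ A' in 𝓝[(fun (A : PBond P j → (specialUnitaryLogChart (Fin N)).lie) (c : PBond P (j + 1)) =>
            (isChartRep_specialUnitaryGroup (n := Fin N)).logChart
              (avgFun (expMeanLogSU (n := Fin N)) (fun b => (isChartRep_specialUnitaryGroup (n := Fin N)).expChart (A b) * U₀ b) c *
                (avgFun (expMeanLogSU (n := Fin N)) U₀ c)⁻¹)) ⁻¹'
              {(fun (A : PBond P j → (specialUnitaryLogChart (Fin N)).lie) (c : PBond P (j + 1)) =>
                (isChartRep_specialUnitaryGroup (n := Fin N)).logChart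
                  (avgFun (expMeanLogSU (n := Fin N)) (fun b => (isChartRep_specialUnitaryGroup (n := Fin N)).expChart (A b) * U₀ b) c *
                    (avgFun (expMeanLogSU (n := Fin N)) U₀ c)⁻¹)) A}] A,
            Γ i ((fun (A : PBond P j → (specialUnitaryLogChart (Fin N)).lie) (c : PBond P (j + 1)) =>
              (isChartRep_specialUnitaryGroup (n := Fin N)).logChart
                (avgFun (expMeanLogSU (n := Fin N)) (fun b => (isChartRep_specialUnitaryGroup (n := Fin N)).expChart (A b) * U₀ b) c *
                  (avgFun (expMeanLogSU (n := Fin N)) U₀ c)⁻¹)) A) A' = 0) → ContinuousAt r A) →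
        (∃ C₀ : ℝ, ∀ A ∈ O, r A ≤ C₀) → (∀ A, A ∉ O → r A = 0) →
        ∃ I : (PBond P (j + 1) → (specialUnitaryLogChart (Fin N)).lie) → ℝ, ContinuousOn I D ∧ (∀ w, 0 ≤ I w) ∧
          ∀ A' : Set (PBond P (j + 1) → (specialUnitaryLogChart (Fin N)).lie), MeasurableSet A' → A' ⊆ D →
            ((Measure.pi fun _ : PBond P j => η).withDensity fun A => ENNReal.ofReal (r A))
                ((fun (A : PBond P j → (specialUnitaryLogChart (Fin N)).lie) (c : PBond P (j + 1)) =>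
                  (isChartRep_specialUnitaryGroup (n := Fin N)).logChart
                    (avgFun (expMeanLogSU (n := Fin N)) (fun b => (isChartRep_specialUnitaryGroup (n := Fin N)).expChart (A b) * U₀ b) c *
                      (avgFun (expMeanLogSU (n := Fin N)) U₀ c)⁻¹)) ⁻¹' A') =
              ∫⁻ w in A', ENNReal.ofReal (I w) ∂(Measure.pi fun _ : PBond P (j + 1) => η) := by
  haveI : (Measure.pi fun _ : PBond P j => η).IsAddHaarMeasure := Measure.pi.isAddHaarMeasure _
  haveI : (Measure.pi fun _ : PBond P (j + 1) => η).IsAddHaarMeasure := Measure.pi.isAddHaarMeasure _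
  have hsmall : ∀ c, Small (expMeanLogSU (n := Fin N)) U₀ c := fun c i => lt_of_le_of_lt (hα c i) hαδ
  exact exists_continuousOn_density_map_of_analytic_submersion_sharp_fibreFlat
    (Measure.pi fun _ : PBond P j => η) (Measure.pi fun _ : PBond P (j + 1) => η)
    (measurable_chartRead_avgFun (P := P) (j := j) U₀)
    (analyticAt_chartRead_avgFun (P := P) (j := j) U₀ hsmall)
    (fderiv_chartRead_avgFun_range_eq_top (P := P) (j := j) hj hα hα24 hαδ hαL) hO₀ h0 hΓan

/-- ★★ **(M3r)-LOCAL, SHARP ENGINE FORM WITHOUT TRANSVERSALITY (plain exemption under `hnf`).**  As `sharpEngineFace_chartRead_avgFun_fibreFlat`, with the displayed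
NOWHERE-FIBRE-FLAT clause `hnf` on `O₀` (a threshold vanishing at `A ∈ O₀` does not vanish identically near `A` along the fibre of `ψ_{U₀}`): the density is asked continuous only at the
points `A ∈ O` where EVERY `Γ i (ψ_{U₀} A) A ≠ 0` — the input shape of dag-n09-w2's `HaarExpChartLocalFaceTransport` §7 ∕ `Node00.RegSetOfLocalFaces.regular_of_sharpEngineFaces`.
dag-n09-w3's `…_of_nowhereFibreFlat` over dag-n09-w4's chart-read data. [cite: Balaban1987RG1, (0.4) p.253, (2.1)–(2.10) pp.265–267; EvansGariepy1992, §3.4.3 Thm 2; Mityagin2015, Prop. 1] -/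
theorem sharpEngineFace_chartRead_avgFun_of_nowhereFibreFlat (hj : j + 1 ≤ P.m + P.K) {α : ℝ} (hα : ∀ c i, dist1 (loopHol U₀ c i) ≤ α)
    (hα24 : α ≤ 1 / 24) (hαδ : α < deltaSU (Fin N)) (hαL : 157 * α < ((P.L : ℝ) ^ (P.d - 1))⁻¹)
    {ι : Type*} [Countable ι]
    {Γ : ι → (PBond P (j + 1) → (specialUnitaryLogChart (Fin N)).lie) → (PBond P j → (specialUnitaryLogChart (Fin N)).lie) → ℝ}
    {O₀ : Set (PBond P j → (specialUnitaryLogChart (Fin N)).lie)} (hO₀ : IsOpen O₀) (h0 : (0 : PBond P j → (specialUnitaryLogChart (Fin N)).lie) ∈ O₀)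
    (hΓan : ∀ i y, AnalyticOnNhd ℝ (Γ i y) O₀)
    (hnf : ∀ A ∈ O₀, ∀ i, Γ i ((fun (A : PBond P j → (specialUnitaryLogChart (Fin N)).lie) (c : PBond P (j + 1)) =>
            (isChartRep_specialUnitaryGroup (n := Fin N)).logChart
              (avgFun (expMeanLogSU (n := Fin N)) (fun b => (isChartRep_specialUnitaryGroup (n := Fin N)).expChart (A b) * U₀ b) c *
                (avgFun (expMeanLogSU (n := Fin N)) U₀ c)⁻¹)) A) A = 0 →
          ∃ᶠ A' in 𝓝[(fun (A : PBond P j → (specialUnitaryLogChart (Fin N)).lie) (c : PBond P (j + 1)) =>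
            (isChartRep_specialUnitaryGroup (n := Fin N)).logChart
              (avgFun (expMeanLogSU (n := Fin N)) (fun b => (isChartRep_specialUnitaryGroup (n := Fin N)).expChart (A b) * U₀ b) c *
                (avgFun (expMeanLogSU (n := Fin N)) U₀ c)⁻¹)) ⁻¹'
              {(fun (A : PBond P j → (specialUnitaryLogChart (Fin N)).lie) (c : PBond P (j + 1)) =>
                (isChartRep_specialUnitaryGroup (n := Fin N)).logChart
                  (avgFun (expMeanLogSU (n := Fin N)) (fun b => (isChartRep_specialUnitaryGroup (n := Fin N)).expChart (A b) * U₀ b) c *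
                    (avgFun (expMeanLogSU (n := Fin N)) U₀ c)⁻¹)) A}] A,
            Γ i ((fun (A : PBond P j → (specialUnitaryLogChart (Fin N)).lie) (c : PBond P (j + 1)) =>
              (isChartRep_specialUnitaryGroup (n := Fin N)).logChart
                (avgFun (expMeanLogSU (n := Fin N)) (fun b => (isChartRep_specialUnitaryGroup (n := Fin N)).expChart (A b) * U₀ b) c *
                  (avgFun (expMeanLogSU (n := Fin N)) U₀ c)⁻¹)) A) A' ≠ 0) :
    ∃ O : Set (PBond P j → (specialUnitaryLogChart (Fin N)).lie), IsOpen O ∧ (0 : PBond P j → (specialUnitaryLogChart (Fin N)).lie) ∈ O ∧ O ⊆ O₀ ∧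
      ∃ D : Set (PBond P (j + 1) → (specialUnitaryLogChart (Fin N)).lie), IsOpen D ∧
      (fun (A : PBond P j → (specialUnitaryLogChart (Fin N)).lie) (c : PBond P (j + 1)) =>
        (isChartRep_specialUnitaryGroup (n := Fin N)).logChart
          (avgFun (expMeanLogSU (n := Fin N)) (fun b => (isChartRep_specialUnitaryGroup (n := Fin N)).expChart (A b) * U₀ b) c *
            (avgFun (expMeanLogSU (n := Fin N)) U₀ c)⁻¹)) 0 ∈ D ∧
      ∀ r : (PBond P j → (specialUnitaryLogChart (Fin N)).lie) → ℝ, Measurable r → (∀ A, 0 ≤ r A) →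
        (∀ A ∈ O, (∀ i, Γ i ((fun (A : PBond P j → (specialUnitaryLogChart (Fin N)).lie) (c : PBond P (j + 1)) =>
            (isChartRep_specialUnitaryGroup (n := Fin N)).logChart
              (avgFun (expMeanLogSU (n := Fin N)) (fun b => (isChartRep_specialUnitaryGroup (n := Fin N)).expChart (A b) * U₀ b) c *
                (avgFun (expMeanLogSU (n := Fin N)) U₀ c)⁻¹)) A) A ≠ 0) → ContinuousAt r A) →
        (∃ C₀ : ℝ, ∀ A ∈ O, r A ≤ C₀) → (∀ A, A ∉ O → r A = 0) →
        ∃ I : (PBond P (j + 1) → (specialUnitaryLogChart (Fin N)).lie) → ℝ, ContinuousOn I D ∧ (∀ w, 0 ≤ I w) ∧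
          ∀ A' : Set (PBond P (j + 1) → (specialUnitaryLogChart (Fin N)).lie), MeasurableSet A' → A' ⊆ D →
            ((Measure.pi fun _ : PBond P j => η).withDensity fun A => ENNReal.ofReal (r A))
                ((fun (A : PBond P j → (specialUnitaryLogChart (Fin N)).lie) (c : PBond P (j + 1)) =>
                  (isChartRep_specialUnitaryGroup (n := Fin N)).logChart
                    (avgFun (expMeanLogSU (n := Fin N)) (fun b => (isChartRep_specialUnitaryGroup (n := Fin N)).expChart (A b) * U₀ b) c *
                      (avgFun (expMeanLogSU (n := Fin N)) U₀ c)⁻¹)) ⁻¹' A') =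
              ∫⁻ w in A', ENNReal.ofReal (I w) ∂(Measure.pi fun _ : PBond P (j + 1) => η) := by
  haveI : (Measure.pi fun _ : PBond P j => η).IsAddHaarMeasure := Measure.pi.isAddHaarMeasure _
  haveI : (Measure.pi fun _ : PBond P (j + 1) => η).IsAddHaarMeasure := Measure.pi.isAddHaarMeasure _
  have hsmall : ∀ c, Small (expMeanLogSU (n := Fin N)) U₀ c := fun c i => lt_of_le_of_lt (hα c i) hαδ
  exact exists_continuousOn_density_map_of_analytic_submersion_sharp_of_nowhereFibreFlat
    (Measure.pi fun _ : PBond P j => η) (Measure.pi fun _ : PBond P (j + 1) => η)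
    (measurable_chartRead_avgFun (P := P) (j := j) U₀)
    (analyticAt_chartRead_avgFun (P := P) (j := j) U₀ hsmall)
    (fderiv_chartRead_avgFun_range_eq_top (P := P) (j := j) hj hα hα24 hαδ hαL) hO₀ h0 hΓan hnf

end Run

/-! ## §2  Record level: the sharp engine faces at every configuration of a guarded set — `hengine` of `regular_of_sharpEngineFaces` -/

section Engine

variable {F : T4Continuum.T4Family} {N : ℕ} [NeZero N] {K k : ℕ}
variable [MeasurableSpace (specialUnitaryLogChart (Fin N)).lie] [BorelSpace (specialUnitaryLogChart (Fin N)).lie]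
  (η : Measure (specialUnitaryLogChart (Fin N)).lie) [η.IsAddHaarMeasure]

/-- ★★ **`hengine` OF dag-n09-w2's `regular_of_sharpEngineFaces`, DISCHARGED ON THE α-GUARD modulo a displayed analytic, nowhere-fibre-flat threshold family.**  At every
`U₀` of a set `K₀` inside the loop α-guard: the averaging of record is continuous at `U₀` (dag-n09-w4's `continuousAt_avgFun_of_small`) AND its chart reading carries at `0` the
SHARP engine face w.r.t. `⊗η` with the flat exemption `A ∈ O₀ U₀ ∧ ∀ i, Γ U₀ i (ψ_{U₀} A) A ≠ 0` (§1 `sharpEngineFace_chartRead_avgFun_of_nowhereFibreFlat`, the window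
inclusion `O ⊆ O₀ U₀` folded into the exemption). [cite: Balaban1987RG1, (0.4) p.253, (2.9) p.266, (2.10) p.267; EvansGariepy1992, §3.4.3 Thm 2; Mityagin2015, Prop. 1] -/
theorem sharpEngineFaces_avOfRecord_of_loopSmall (hk : k < K) {α : ℝ} (hα24 : α ≤ 1 / 24) (hαδ : α < deltaSU (Fin N))
    (hαL : 157 * α < (((F.P K).L : ℝ) ^ ((F.P K).d - 1))⁻¹) {K₀ : Set (GaugeField (F.P K) k (SU N))}
    (hK₀α : ∀ U ∈ K₀, ∀ c i, dist1 (loopHol U c i) ≤ α)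
    {ι : Type*} [Countable ι]
    (Γ : GaugeField (F.P K) k (SU N) → ι → (PBond (F.P K) (k + 1) → (specialUnitaryLogChart (Fin N)).lie) →
      (PBond (F.P K) k → (specialUnitaryLogChart (Fin N)).lie) → ℝ)
    (O₀ : GaugeField (F.P K) k (SU N) → Set (PBond (F.P K) k → (specialUnitaryLogChart (Fin N)).lie))
    (hO₀ : ∀ U₀ ∈ K₀, IsOpen (O₀ U₀)) (h0 : ∀ U₀ ∈ K₀, (0 : PBond (F.P K) k → (specialUnitaryLogChart (Fin N)).lie) ∈ O₀ U₀)
    (hΓan : ∀ U₀ ∈ K₀, ∀ i y, AnalyticOnNhd ℝ (Γ U₀ i y) (O₀ U₀))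
    (hnf : ∀ U₀ ∈ K₀, ∀ A ∈ O₀ U₀, ∀ i,
      Γ U₀ i ((fun A : PBond (F.P K) k → (specialUnitaryLogChart (Fin N)).lie =>
          (fun (V : PBond (F.P K) (k + 1) → SU N) (c : PBond (F.P K) (k + 1)) =>
            (isChartRep_specialUnitaryGroup (n := Fin N)).logChart (V c * ((avOfRecord F N K k).avg U₀ c)⁻¹))
            ((avOfRecord F N K k).avg
              (fun b => (isChartRep_specialUnitaryGroup (n := Fin N)).expChart (A b) * U₀ b))) A) A = 0 →
      ∃ᶠ A' in 𝓝[(fun A : PBond (F.P K) k → (specialUnitaryLogChart (Fin N)).lie =>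
          (fun (V : PBond (F.P K) (k + 1) → SU N) (c : PBond (F.P K) (k + 1)) =>
            (isChartRep_specialUnitaryGroup (n := Fin N)).logChart (V c * ((avOfRecord F N K k).avg U₀ c)⁻¹))
            ((avOfRecord F N K k).avg
              (fun b => (isChartRep_specialUnitaryGroup (n := Fin N)).expChart (A b) * U₀ b))) ⁻¹'
            {(fun A : PBond (F.P K) k → (specialUnitaryLogChart (Fin N)).lie =>
              (fun (V : PBond (F.P K) (k + 1) → SU N) (c : PBond (F.P K) (k + 1)) =>
                (isChartRep_specialUnitaryGroup (n := Fin N)).logChart (V c * ((avOfRecord F N K k).avg U₀ c)⁻¹))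
                ((avOfRecord F N K k).avg
                  (fun b => (isChartRep_specialUnitaryGroup (n := Fin N)).expChart (A b) * U₀ b))) A}] A,
        Γ U₀ i ((fun A : PBond (F.P K) k → (specialUnitaryLogChart (Fin N)).lie =>
            (fun (V : PBond (F.P K) (k + 1) → SU N) (c : PBond (F.P K) (k + 1)) =>
              (isChartRep_specialUnitaryGroup (n := Fin N)).logChart (V c * ((avOfRecord F N K k).avg U₀ c)⁻¹))
              ((avOfRecord F N K k).avg
                (fun b => (isChartRep_specialUnitaryGroup (n := Fin N)).expChart (A b) * U₀ b))) A) A' ≠ 0) :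
    ∀ U₀ ∈ K₀, ContinuousAt (avOfRecord F N K k).avg U₀ ∧
      ∃ O : Set (PBond (F.P K) k → (specialUnitaryLogChart (Fin N)).lie), IsOpen O ∧
        (0 : PBond (F.P K) k → (specialUnitaryLogChart (Fin N)).lie) ∈ O ∧
        ∃ D : Set (PBond (F.P K) (k + 1) → (specialUnitaryLogChart (Fin N)).lie), IsOpen D ∧
        (fun A : PBond (F.P K) k → (specialUnitaryLogChart (Fin N)).lie =>
            (fun (V : PBond (F.P K) (k + 1) → SU N) (c : PBond (F.P K) (k + 1)) =>
              (isChartRep_specialUnitaryGroup (n := Fin N)).logChart (V c * ((avOfRecord F N K k).avg U₀ c)⁻¹))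
              ((avOfRecord F N K k).avg
                (fun b => (isChartRep_specialUnitaryGroup (n := Fin N)).expChart (A b) * U₀ b))) 0 ∈ D ∧
        ∀ r : (PBond (F.P K) k → (specialUnitaryLogChart (Fin N)).lie) → ℝ, Measurable r → (∀ A, 0 ≤ r A) →
          (∀ A ∈ O, (A ∈ O₀ U₀ ∧ ∀ i, Γ U₀ i ((fun A : PBond (F.P K) k → (specialUnitaryLogChart (Fin N)).lie =>
              (fun (V : PBond (F.P K) (k + 1) → SU N) (c : PBond (F.P K) (k + 1)) =>
                (isChartRep_specialUnitaryGroup (n := Fin N)).logChart (V c * ((avOfRecord F N K k).avg U₀ c)⁻¹))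
                ((avOfRecord F N K k).avg
                  (fun b => (isChartRep_specialUnitaryGroup (n := Fin N)).expChart (A b) * U₀ b))) A) A ≠ 0) → ContinuousAt r A) →
          (∃ C₀ : ℝ, ∀ A ∈ O, r A ≤ C₀) → (∀ A, A ∉ O → r A = 0) →
          ∃ I : (PBond (F.P K) (k + 1) → (specialUnitaryLogChart (Fin N)).lie) → ℝ, ContinuousOn I D ∧ (∀ w, 0 ≤ I w) ∧
            ∀ A' : Set (PBond (F.P K) (k + 1) → (specialUnitaryLogChart (Fin N)).lie), MeasurableSet A' → A' ⊆ D →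
              ((Measure.pi fun _ : PBond (F.P K) k => η).withDensity fun A => ENNReal.ofReal (r A))
                  ((fun A : PBond (F.P K) k → (specialUnitaryLogChart (Fin N)).lie =>
                      (fun (V : PBond (F.P K) (k + 1) → SU N) (c : PBond (F.P K) (k + 1)) =>
                        (isChartRep_specialUnitaryGroup (n := Fin N)).logChart (V c * ((avOfRecord F N K k).avg U₀ c)⁻¹))
                        ((avOfRecord F N K k).avg
                          (fun b => (isChartRep_specialUnitaryGroup (n := Fin N)).expChart (A b) * U₀ b))) ⁻¹' A') =
                ∫⁻ w in A', ENNReal.ofReal (I w) ∂(Measure.pi fun _ : PBond (F.P K) (k + 1) => η) := by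
  intro U₀ hU₀
  have hsmall : ∀ c, Small (expMeanLogSU (n := Fin N)) U₀ c := fun c i => lt_of_le_of_lt (hK₀α U₀ hU₀ c i) hαδ
  have hj : k + 1 ≤ (F.P K).m + (F.P K).K := by simp only [T4Continuum.T4Family.P_K]; omega
  refine ⟨continuousAt_avgFun_of_small (P := F.P K) (j := k) U₀ hsmall, ?_⟩
  obtain ⟨O, hO, h0O, hOO₀, D, hD, hψD, hface⟩ :=
    sharpEngineFace_chartRead_avgFun_of_nowhereFibreFlat (P := F.P K) (j := k) U₀ η hj (hK₀α U₀ hU₀) hα24 hαδ hαL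
      (hO₀ U₀ hU₀) (h0 U₀ hU₀) (hΓan U₀ hU₀) (hnf U₀ hU₀)
  exact ⟨O, hO, h0O, D, hD, hψD, fun r hrm hr0 hrc hrC hrO =>
    hface r hrm hr0 (fun A hA hΓ => hrc A hA ⟨hOO₀ hA, hΓ⟩) hrC hrO⟩

end Engine

/-! ## §3  Record level: the regular set, `HasContTransportOn`, continuity of `TcanOfRecord`, and the `hreg` shape — for densities continuous OFF the thresholds -/

section Regular

variable {F : T4Continuum.T4Family} {N : ℕ} [NeZero N] {K k : ℕ}

/-- ★★★ **THE LOCAL ROUTE CLOSED FOR THRESHOLD-CUT DENSITIES ON THE α-GUARD (modulo the displayed threshold family).**  For `k < K`, `ρ ≥ 0` measurable and bounded, zero off a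
closed `K₀` inside the loop α-guard and continuous at the points `U ∈ K₀` with `Q U`; per `U₀ ∈ K₀` a countable family of thresholds `Γ U₀ i`, real-analytic in the fine chart variable
on an open window `O₀ U₀ ∋ 0`, nowhere fibre-flat there (`hnf`), and such that OFF their zero sets the translated chart lands in `Q` (`hQ`): every open set `U` of coarse fields lies in
`regSetOfRecord F N K k ρ` with `HasContTransportOn F N K k ρ U`, and the canonical transport `TcanOfRecord F N K k ρ` is continuous on ALL coarse fields — dag-n09-w2's
`regular_of_sharpEngineFaces` with `Qflat U₀ A := A ∈ O₀ U₀ ∧ ∀ i, Γ U₀ i (ψ_{U₀} A) A ≠ 0` and `hengine :=` §2. [cite: Balaban1987RG1, (0.13) p.254 and p.259, (2.9) p.266, (2.10) p.267] -/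
theorem regular_of_loopSmall_sharp (hk : k < K) {α : ℝ} (hα24 : α ≤ 1 / 24) (hαδ : α < deltaSU (Fin N))
    (hαL : 157 * α < (((F.P K).L : ℝ) ^ ((F.P K).d - 1))⁻¹) {ρ : Density (F.P K) k (SU N)}
    (hρm : Measurable ρ) (hρ0 : ∀ U, 0 ≤ ρ U) (hρC : ∃ C₀ : ℝ, ∀ U, ρ U ≤ C₀) (Q : GaugeField (F.P K) k (SU N) → Prop)
    {K₀ : Set (GaugeField (F.P K) k (SU N))} (hK₀ : IsClosed K₀) (hρK : ∀ U, U ∉ K₀ → ρ U = 0) (hρc : ∀ U ∈ K₀, Q U → ContinuousAt ρ U)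
    (hK₀α : ∀ U ∈ K₀, ∀ c i, dist1 (loopHol U c i) ≤ α)
    {ι : Type*} [Countable ι]
    (Γ : GaugeField (F.P K) k (SU N) → ι → (PBond (F.P K) (k + 1) → (specialUnitaryLogChart (Fin N)).lie) →
      (PBond (F.P K) k → (specialUnitaryLogChart (Fin N)).lie) → ℝ)
    (O₀ : GaugeField (F.P K) k (SU N) → Set (PBond (F.P K) k → (specialUnitaryLogChart (Fin N)).lie))
    (hO₀ : ∀ U₀ ∈ K₀, IsOpen (O₀ U₀)) (h0 : ∀ U₀ ∈ K₀, (0 : PBond (F.P K) k → (specialUnitaryLogChart (Fin N)).lie) ∈ O₀ U₀)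
    (hΓan : ∀ U₀ ∈ K₀, ∀ i y, AnalyticOnNhd ℝ (Γ U₀ i y) (O₀ U₀))
    (hnf : ∀ U₀ ∈ K₀, ∀ A ∈ O₀ U₀, ∀ i,
      Γ U₀ i ((fun A : PBond (F.P K) k → (specialUnitaryLogChart (Fin N)).lie =>
          (fun (V : PBond (F.P K) (k + 1) → SU N) (c : PBond (F.P K) (k + 1)) =>
            (isChartRep_specialUnitaryGroup (n := Fin N)).logChart (V c * ((avOfRecord F N K k).avg U₀ c)⁻¹))
            ((avOfRecord F N K k).avg
              (fun b => (isChartRep_specialUnitaryGroup (n := Fin N)).expChart (A b) * U₀ b))) A) A = 0 →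
      ∃ᶠ A' in 𝓝[(fun A : PBond (F.P K) k → (specialUnitaryLogChart (Fin N)).lie =>
          (fun (V : PBond (F.P K) (k + 1) → SU N) (c : PBond (F.P K) (k + 1)) =>
            (isChartRep_specialUnitaryGroup (n := Fin N)).logChart (V c * ((avOfRecord F N K k).avg U₀ c)⁻¹))
            ((avOfRecord F N K k).avg
              (fun b => (isChartRep_specialUnitaryGroup (n := Fin N)).expChart (A b) * U₀ b))) ⁻¹'
            {(fun A : PBond (F.P K) k → (specialUnitaryLogChart (Fin N)).lie =>
              (fun (V : PBond (F.P K) (k + 1) → SU N) (c : PBond (F.P K) (k + 1)) =>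
                (isChartRep_specialUnitaryGroup (n := Fin N)).logChart (V c * ((avOfRecord F N K k).avg U₀ c)⁻¹))
                ((avOfRecord F N K k).avg
                  (fun b => (isChartRep_specialUnitaryGroup (n := Fin N)).expChart (A b) * U₀ b))) A}] A,
        Γ U₀ i ((fun A : PBond (F.P K) k → (specialUnitaryLogChart (Fin N)).lie =>
            (fun (V : PBond (F.P K) (k + 1) → SU N) (c : PBond (F.P K) (k + 1)) =>
              (isChartRep_specialUnitaryGroup (n := Fin N)).logChart (V c * ((avOfRecord F N K k).avg U₀ c)⁻¹))
              ((avOfRecord F N K k).avg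
                (fun b => (isChartRep_specialUnitaryGroup (n := Fin N)).expChart (A b) * U₀ b))) A) A' ≠ 0)
    (hQ : ∀ U₀ ∈ K₀, ∀ A ∈ O₀ U₀, (∀ i,
      Γ U₀ i ((fun A : PBond (F.P K) k → (specialUnitaryLogChart (Fin N)).lie =>
          (fun (V : PBond (F.P K) (k + 1) → SU N) (c : PBond (F.P K) (k + 1)) =>
            (isChartRep_specialUnitaryGroup (n := Fin N)).logChart (V c * ((avOfRecord F N K k).avg U₀ c)⁻¹))
            ((avOfRecord F N K k).avg
              (fun b => (isChartRep_specialUnitaryGroup (n := Fin N)).expChart (A b) * U₀ b))) A) A ≠ 0) →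
      Q (fun b => (isChartRep_specialUnitaryGroup (n := Fin N)).expChart (A b) * U₀ b)) :
    (∀ U : Set (PBond (F.P K) (k + 1) → SU N), IsOpen U → U ⊆ regSetOfRecord F N K k ρ ∧ HasContTransportOn F N K k ρ U) ∧
      Continuous (TcanOfRecord F N K k ρ) := by
  letI : MeasurableSpace (specialUnitaryLogChart (Fin N)).lie := borel _
  haveI : BorelSpace (specialUnitaryLogChart (Fin N)).lie := ⟨rfl⟩
  exact RegSetOfLocalFaces.regular_of_sharpEngineFaces (Module.finBasis ℝ (specialUnitaryLogChart (Fin N)).lie).addHaar hk hρm hρ0 hρC Q hK₀ hρK hρc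
    (fun U₀ A => A ∈ O₀ U₀ ∧ ∀ i,
      Γ U₀ i ((fun A : PBond (F.P K) k → (specialUnitaryLogChart (Fin N)).lie =>
          (fun (V : PBond (F.P K) (k + 1) → SU N) (c : PBond (F.P K) (k + 1)) =>
            (isChartRep_specialUnitaryGroup (n := Fin N)).logChart (V c * ((avOfRecord F N K k).avg U₀ c)⁻¹))
            ((avOfRecord F N K k).avg
              (fun b => (isChartRep_specialUnitaryGroup (n := Fin N)).expChart (A b) * U₀ b))) A) A ≠ 0)
    (fun U₀ hU₀ A hA => hQ U₀ hU₀ A hA.1 hA.2)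
    (sharpEngineFaces_avOfRecord_of_loopSmall _ hk hα24 hαδ hαL hK₀α Γ O₀ hO₀ h0 hΓan hnf)

/-- ★ **THE `hreg` SHAPE FOR THRESHOLD-CUT GUARDED DENSITIES**: `domAltOfRecord F N ν K (k+1) ⊆ regSetOfRecord F N K k ρ` — the binder of the N09 small-field-bookkeeping doors
(`…N09B0RiderAtRecord`, dag-n09-w2's `…N09HregOfLocalFacesAtRecord`), for every bounded `ρ ≥ 0` on a closed subset of the α-guard, zero off it, continuous OFF the zero sets of a displayed
analytic nowhere-fibre-flat threshold family (the (2.9) second-form domain is open, `isOpen_domAltOfRecord`).  The record's threshold family and the continuity of its β-input off the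
thresholds are NOT supplied here. [cite: Balaban1987RG1, p.259, (2.9) p.266] -/
theorem domAlt_subset_regSetOfRecord_of_loopSmall_sharp (ν : Stage7Numerics) (hk : k < K) {α : ℝ} (hα24 : α ≤ 1 / 24) (hαδ : α < deltaSU (Fin N))
    (hαL : 157 * α < (((F.P K).L : ℝ) ^ ((F.P K).d - 1))⁻¹) {ρ : Density (F.P K) k (SU N)}
    (hρm : Measurable ρ) (hρ0 : ∀ U, 0 ≤ ρ U) (hρC : ∃ C₀ : ℝ, ∀ U, ρ U ≤ C₀) (Q : GaugeField (F.P K) k (SU N) → Prop)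
    {K₀ : Set (GaugeField (F.P K) k (SU N))} (hK₀ : IsClosed K₀) (hρK : ∀ U, U ∉ K₀ → ρ U = 0) (hρc : ∀ U ∈ K₀, Q U → ContinuousAt ρ U)
    (hK₀α : ∀ U ∈ K₀, ∀ c i, dist1 (loopHol U c i) ≤ α)
    {ι : Type*} [Countable ι]
    (Γ : GaugeField (F.P K) k (SU N) → ι → (PBond (F.P K) (k + 1) → (specialUnitaryLogChart (Fin N)).lie) →
      (PBond (F.P K) k → (specialUnitaryLogChart (Fin N)).lie) → ℝ)
    (O₀ : GaugeField (F.P K) k (SU N) → Set (PBond (F.P K) k → (specialUnitaryLogChart (Fin N)).lie))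
    (hO₀ : ∀ U₀ ∈ K₀, IsOpen (O₀ U₀)) (h0 : ∀ U₀ ∈ K₀, (0 : PBond (F.P K) k → (specialUnitaryLogChart (Fin N)).lie) ∈ O₀ U₀)
    (hΓan : ∀ U₀ ∈ K₀, ∀ i y, AnalyticOnNhd ℝ (Γ U₀ i y) (O₀ U₀))
    (hnf : ∀ U₀ ∈ K₀, ∀ A ∈ O₀ U₀, ∀ i,
      Γ U₀ i ((fun A : PBond (F.P K) k → (specialUnitaryLogChart (Fin N)).lie =>
          (fun (V : PBond (F.P K) (k + 1) → SU N) (c : PBond (F.P K) (k + 1)) =>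
            (isChartRep_specialUnitaryGroup (n := Fin N)).logChart (V c * ((avOfRecord F N K k).avg U₀ c)⁻¹))
            ((avOfRecord F N K k).avg
              (fun b => (isChartRep_specialUnitaryGroup (n := Fin N)).expChart (A b) * U₀ b))) A) A = 0 →
      ∃ᶠ A' in 𝓝[(fun A : PBond (F.P K) k → (specialUnitaryLogChart (Fin N)).lie =>
          (fun (V : PBond (F.P K) (k + 1) → SU N) (c : PBond (F.P K) (k + 1)) =>
            (isChartRep_specialUnitaryGroup (n := Fin N)).logChart (V c * ((avOfRecord F N K k).avg U₀ c)⁻¹))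
            ((avOfRecord F N K k).avg
              (fun b => (isChartRep_specialUnitaryGroup (n := Fin N)).expChart (A b) * U₀ b))) ⁻¹'
            {(fun A : PBond (F.P K) k → (specialUnitaryLogChart (Fin N)).lie =>
              (fun (V : PBond (F.P K) (k + 1) → SU N) (c : PBond (F.P K) (k + 1)) =>
                (isChartRep_specialUnitaryGroup (n := Fin N)).logChart (V c * ((avOfRecord F N K k).avg U₀ c)⁻¹))
                ((avOfRecord F N K k).avg
                  (fun b => (isChartRep_specialUnitaryGroup (n := Fin N)).expChart (A b) * U₀ b))) A}] A,
        Γ U₀ i ((fun A : PBond (F.P K) k → (specialUnitaryLogChart (Fin N)).lie =>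
            (fun (V : PBond (F.P K) (k + 1) → SU N) (c : PBond (F.P K) (k + 1)) =>
              (isChartRep_specialUnitaryGroup (n := Fin N)).logChart (V c * ((avOfRecord F N K k).avg U₀ c)⁻¹))
              ((avOfRecord F N K k).avg
                (fun b => (isChartRep_specialUnitaryGroup (n := Fin N)).expChart (A b) * U₀ b))) A) A' ≠ 0)
    (hQ : ∀ U₀ ∈ K₀, ∀ A ∈ O₀ U₀, (∀ i,
      Γ U₀ i ((fun A : PBond (F.P K) k → (specialUnitaryLogChart (Fin N)).lie =>
          (fun (V : PBond (F.P K) (k + 1) → SU N) (c : PBond (F.P K) (k + 1)) =>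
            (isChartRep_specialUnitaryGroup (n := Fin N)).logChart (V c * ((avOfRecord F N K k).avg U₀ c)⁻¹))
            ((avOfRecord F N K k).avg
              (fun b => (isChartRep_specialUnitaryGroup (n := Fin N)).expChart (A b) * U₀ b))) A) A ≠ 0) →
      Q (fun b => (isChartRep_specialUnitaryGroup (n := Fin N)).expChart (A b) * U₀ b)) :
    domAltOfRecord F N ν K (k + 1) ⊆ regSetOfRecord F N K k ρ :=
  ((regular_of_loopSmall_sharp hk hα24 hαδ hαL hρm hρ0 hρC Q hK₀ hρK hρc hK₀α Γ O₀ hO₀ h0 hΓan hnf hQ).1 _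
    (B12ContinuousTransportInvarianceOn.isOpen_domAltOfRecord (F := F) (N := N) ν K (k + 1))).1

end Regular

end Summit.QuantumFields.YangMills.BalabanUVNodes.N09ContTransportOfLoopSmallSharp

end
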